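import Summits.HodgeConjecture.HodgeCM.PerL34.RallisHaar_1

/-! PORT of `HodgeCM/PerL34/RallisHaar.lean` (HodgeCMPerL run 82) — part 2: continuation of `Summits.HodgeConjecture.HodgeCM.PerL34.RallisHaar_1` (split at a top-level declaration boundary by port_pkg.py; scope re-opened below; declarations unchanged). -/

-- port_pkg: scope re-opened for this part (file-level context, then the namespace/section stack open at the cut)
set_option autoImplicit false
noncomputable section
open MeasureTheory Set Filter Function Topology Complex ComplexConjugate
open scoped RestrictedProduct InnerProductSpace
namespace HodgeCM.PerL34.PureTensor
open HodgeCM.PerL34.AdelicFactorisation HodgeCM.PerL34.RestrictedMeasure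
  HodgeCM.PerL34.NoSmallSubgroups HodgeCM.PerL34.EulerFactorisation
section n31d
open HodgeCM.PerL34.RallisIP HodgeCM.PerL34.Doubling HodgeCM.PerL34.N31d
variable {ι : Type} {G : ι → Type} [∀ i, CommGroup (G i)] [∀ i, TopologicalSpace (G i)]
  [∀ i, IsTopologicalGroup (G i)] [∀ i, T2Space (G i)] [∀ i, SecondCountableTopology (G i)]
  [∀ i, LocallyCompactSpace (G i)] [∀ i, MeasurableSpace (G i)] [∀ i, BorelSpace (G i)]
  [Countable ι] [DecidableEq ι]
  (B : ∀ i, Subgroup (G i)) (hBc : ∀ i, IsCompact (B i : Set (G i)))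
  (hBo : ∀ i, IsOpen (B i : Set (G i))) (S₀ : Finset ι)
  {Sp : Type} [NormedAddCommGroup Sp] [InnerProductSpace ℂ Sp]
  {E : Type*} [NormedAddCommGroup E] [InnerProductSpace ℂ E]
  -- pv05's doubling datum over `A := Πʳ_i [G_i, B_i]` and pv15's `G_U`-side data (DATA, D4)
  {L : Type} [Field L] [StarRing L] {W : Type} [AddCommGroup W] [Module L W]
  {H Sbox : Type} [Group H] [AddCommGroup Sbox] [Module ℂ Sbox]
  {h : W →ₗ⋆[L] W →ₗ[L] L} (hW : IsLine L W) (hh : Anisotropic h)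
  (D : DoublingDatum (Πʳ j, [G j, B j]) H Sp Sbox) (GU : ThetaSide Sp Sbox)
  -- rational set-up (gen 1, verbatim)
  [Countable (unitary L)] (jA : unitary L →* Πʳ j, [G j, B j]) (hjA : Function.Injective jA)
  (j : isomBox h →* H) (hj : ∀ d : unitary L, j ⟨iotaSnd d, iotaSnd_mem h d⟩ = D.ι (1, jA d))
  {𝓕 : Set (Πʳ j, [G j, B j])} (h𝓕 : IsFundamentalDomain jA.range 𝓕 (haarDatum B hBc hBo S₀).μ)
  (χ : (Πʳ j, [G j, B j]) →* Circle) (hχΓ : ∀ d : unitary L, χ (jA d) = 1)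
  (hχVΓ : ∀ d : unitary L, D.χV (jA d) = 1)
  -- N31d's print inputs (pv15 `GluePrintInputs`) and pv05's `hP` (`f_Ψ(·,s₀)` left `P(L₀)`-invariant)
  {hP : ∀ Ψ : Sbox, ∀ p ∈ (stabDelta L W).subgroupOf (isomBox h), ∀ x : H,
    D.fSW Ψ (j p * x) = D.fSW Ψ x}
  (P : GluePrintInputs D GU h j hP) (φ : Sp)
  -- representation side (the S3 end theorem's binders, for `ω := D.ω`)
  (hφ : ‖φ‖ = 1)
  (hloc : ∀ (i : ι) (v : Sp), Continuous fun g : G i => D.ω (RestrictedProduct.mulSingle B i g) v)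
  {T' : Finset ι} (hχT' : RestrictedProduct.boxSubgroup B T' ≤ χ.ker)
  (hlocχ : ∀ i ∈ T', Continuous fun g : G i => χ (RestrictedProduct.mulSingle B i g))
  {T : Finset ι} (hK : ∀ k ∈ RestrictedProduct.boxSubgroup B T, D.ω k φ = φ)
  (hM : ∀ S : Finset ι, T ⊆ S → ∀ y : (i : ↥S) → G i,
    inner ℂ φ (D.ω (extendOne B S y) φ) = ∏ i : ↥S, localCoeff B D.ω φ i (y i))
  {S : Finset ι} {q : ι → ℕ} {chiPi nuPi : ι → ℂ} {IsSplit : ι → Prop}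
  (X : UnramifiedPlaceData B (haarDatum B hBc hBo S₀) D.ω φ χ S q chiPi nuPi IsSplit)
  (hTS : T ⊆ S) (hT'S : T' ⊆ S)
  (hclS : ∀ i ∈ S, Integrable (localCoeff B D.ω φ i) ((haarDatum B hBc hBo S₀).ν i))
  (hsum : Summable fun i : {j : ι // j ∉ S} => EulerProduct.tOf (q i.1))
  -- the volume / Petersson side
  (vol_ne_top : (haarDatum B hBc hBo S₀).μ 𝓕 ≠ ⊤) (θ : E) (Θ : Set E) (hθ : θ ∈ Θ)
  (hnorm : ⟪θ, θ⟫_ℂ = ∫ u in 𝓕, ∫ u' in 𝓕, ((χ u : Circle) : ℂ) * conj ((χ u' : Circle) : ℂ) *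
    thetaKernel D GU φ u u' ∂(haarDatum B hBc hBo S₀).μ ∂(haarDatum B hBc hBo S₀).μ)
  (ram_pos : ∀ i ∈ S, 0 < (localIntegrand B (haarDatum B hBc hBo S₀) D.ω φ χ i).I)
include hW hh hjA hj h𝓕 hχΓ hχVΓ P hφ hloc hχT' hlocχ hK hM X hTS hT'S hclS hsum vol_ne_top hθ
  hnorm ram_pos in
/-- **`θ ≠ 0` from node N31d's print inputs, every intermediate node BY NAME** — N31d
(`SiegelWeil.N31d_statement_holds` through pv15's `N31e_of_N31d`: the Siegel–Weil constant `c > 0`,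
summability of the Eisenstein series and the kernel identity for the THETA KERNEL
`K(u,u′) = ∫_{[G_U]} θ_φ(g,u) θ̄_φ(g,u′) dg`) ⟹ N31e (gen 1 `RallisIP.N31e_holds`, its `hint` and
measurable-group structure discharged here) ⟹ seam (I) + N31g/N31h (gen 3 `theta_ne_zero_haar`) over
the canonical Haar datum.  Remaining inputs: pv05's datum `D` and `hP`, pv15's `G_U`-side data and
`GluePrintInputs`, the rational set-up and fundamental domain, the representation-side data (levels,
local continuity, product formula, place data), `hnorm` (Petersson/Fubini for the theta kernel). -/
theorem theta_ne_zero_of_N31d : θ ≠ 0 := by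
  haveI : Fact (∀ i, IsOpen (B i : Set (G i))) := ⟨hBo⟩
  haveI : BorelSpace (Πʳ i, [G i, B i]) := borelSpace_rp B hBo
  haveI : MeasurableMul₂ (Πʳ i, [G i, B i]) := measurableMul₂_rp B hBo
  haveI : MeasurableInv (Πʳ i, [G i, B i]) := measurableInv_rp B hBo
  haveI : Countable (jA.range : Subgroup (Πʳ j, [G j, B j])) :=
    Countable.of_equiv _ (MonoidHom.ofInjective hjA).toEquiv
  have hχ : Continuous χ := continuous_char B hBo χ hχT' hlocχ
  obtain ⟨c, c_pos, hN31e⟩ := N31e_of_N31d hW hh (haarDatum B hBc hBo S₀).μ jA hjA hj h𝓕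
    (fun y => ((χ y : Circle) : ℂ))
    (isAutChar_coe χ jA.range (by rintro _ ⟨d, rfl⟩; exact hχΓ d))
    (continuous_subtype_val.comp hχ).measurable hχVΓ P φ
    (integrable_coeff_haarDatum B hBc hBo S₀ D.ω φ hφ hloc χ hχT' hlocχ hK hM X hTS hclS hsum)
  exact theta_ne_zero_haar B hBc hBo S₀ D.ω φ hφ (continuous_orbit B D.ω φ hK hloc) χ hχ 𝓕
    (thetaKernel D GU φ) c c_pos (haarDatum_vol_ne_zero_of_isFundamentalDomain B hBc hBo S₀ h𝓕)
    vol_ne_top θ Θ hθ hN31e hnorm hK hχT' hM X hTS hT'S hclS ram_pos hsum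

end n31d

/-! ## §7 The genuine theta lift `θ_φ(χ′) ∈ L²([G_U])` is non-zero (`hnorm`, `θ`, `E` discharged) -/

section thetaLift

open HodgeCM.PerL34.RallisIP HodgeCM.PerL34.Doubling HodgeCM.PerL34.N31d

variable {ι : Type} {G : ι → Type} [∀ i, CommGroup (G i)] [∀ i, TopologicalSpace (G i)]
  [∀ i, IsTopologicalGroup (G i)] [∀ i, T2Space (G i)] [∀ i, SecondCountableTopology (G i)]
  [∀ i, LocallyCompactSpace (G i)] [∀ i, MeasurableSpace (G i)] [∀ i, BorelSpace (G i)]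
  [Countable ι] [DecidableEq ι]
  (B : ∀ i, Subgroup (G i)) (hBc : ∀ i, IsCompact (B i : Set (G i)))
  (hBo : ∀ i, IsOpen (B i : Set (G i))) (S₀ : Finset ι)

omit [∀ i, T2Space (G i)] [∀ i, LocallyCompactSpace (G i)] in
include hBo in
/-- `χ′ := (χ : A → ℂ)` is measurable for a unitary character of level `K_{T′}` with continuous
local components on `T′` (pv09-g3 `continuous_char` + Borel agreement). -/
theorem measurable_coe_char (χ : (Πʳ j, [G j, B j]) →* Circle) {T' : Finset ι}
    (hχT' : RestrictedProduct.boxSubgroup B T' ≤ χ.ker)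
    (hlocχ : ∀ i ∈ T', Continuous fun g : G i => χ (RestrictedProduct.mulSingle B i g)) :
    Measurable fun y : Πʳ j, [G j, B j] => ((χ y : Circle) : ℂ) := by
  haveI : BorelSpace (Πʳ i, [G i, B i]) := borelSpace_rp B hBo
  exact (continuous_subtype_val.comp (continuous_char B hBo χ hχT' hlocχ)).measurable

omit [∀ i, LocallyCompactSpace (G i)] [DecidableEq ι] in
/-- A relatively compact `𝓕` has finite Haar volume, as the instance the theta lift needs. -/
theorem isFiniteMeasure_restrict_haarDatum {𝓕 : Set (Πʳ i, [G i, B i])}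
    (h𝓕c : IsCompact (closure 𝓕)) : IsFiniteMeasure (((haarDatum B hBc hBo S₀).μ).restrict 𝓕) :=
  isFiniteMeasure_restrict.mpr (haarDatum_vol_ne_top_of_closure B hBc hBo S₀ h𝓕c)

variable {Sp : Type} [NormedAddCommGroup Sp] [InnerProductSpace ℂ Sp]
  {L : Type} [Field L] [StarRing L] {W : Type} [AddCommGroup W] [Module L W]
  {H Sbox : Type} [Group H] [AddCommGroup Sbox] [Module ℂ Sbox]
  {h : W →ₗ⋆[L] W →ₗ[L] L} (hW : IsLine L W) (hh : Anisotropic h)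
  (D : DoublingDatum (Πʳ j, [G j, B j]) H Sp Sbox) (GU : ThetaSide Sp Sbox) [IsFiniteMeasure GU.μ]
  [Countable (unitary L)] (jA : unitary L →* Πʳ j, [G j, B j]) (hjA : Function.Injective jA)
  (j : isomBox h →* H) (hj : ∀ d : unitary L, j ⟨iotaSnd d, iotaSnd_mem h d⟩ = D.ι (1, jA d))
  {𝓕 : Set (Πʳ j, [G j, B j])} (h𝓕 : IsFundamentalDomain jA.range 𝓕 (haarDatum B hBc hBo S₀).μ)
  [IsFiniteMeasure (((haarDatum B hBc hBo S₀).μ).restrict 𝓕)]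
  (χ : (Πʳ j, [G j, B j]) →* Circle) (hχΓ : ∀ d : unitary L, χ (jA d) = 1)
  (hχVΓ : ∀ d : unitary L, D.χV (jA d) = 1)
  {hP : ∀ Ψ : Sbox, ∀ p ∈ (stabDelta L W).subgroupOf (isomBox h), ∀ x : H,
    D.fSW Ψ (j p * x) = D.fSW Ψ x}
  (P : GluePrintInputs D GU h j hP) (φ : Sp)
  (hφ : ‖φ‖ = 1)
  (hloc : ∀ (i : ι) (v : Sp), Continuous fun g : G i => D.ω (RestrictedProduct.mulSingle B i g) v)
  {T' : Finset ι} (hχT' : RestrictedProduct.boxSubgroup B T' ≤ χ.ker)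
  (hlocχ : ∀ i ∈ T', Continuous fun g : G i => χ (RestrictedProduct.mulSingle B i g))
  {T : Finset ι} (hK : ∀ k ∈ RestrictedProduct.boxSubgroup B T, D.ω k φ = φ)
  (hM : ∀ S : Finset ι, T ⊆ S → ∀ y : (i : ↥S) → G i,
    inner ℂ φ (D.ω (extendOne B S y) φ) = ∏ i : ↥S, localCoeff B D.ω φ i (y i))
  {S : Finset ι} {q : ι → ℕ} {chiPi nuPi : ι → ℂ} {IsSplit : ι → Prop}
  (X : UnramifiedPlaceData B (haarDatum B hBc hBo S₀) D.ω φ χ S q chiPi nuPi IsSplit)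
  (hTS : T ⊆ S) (hT'S : T' ⊆ S)
  (hclS : ∀ i ∈ S, Integrable (localCoeff B D.ω φ i) ((haarDatum B hBc hBo S₀).ν i))
  (hsum : Summable fun i : {j : ι // j ∉ S} => EulerProduct.tOf (q i.1))
  (ram_pos : ∀ i ∈ S, 0 < (localIntegrand B (haarDatum B hBc hBo S₀) D.ω φ χ i).I)
  -- the theta kernel θ_φ(g,u) := Θ(ω(u,g)φ) on [G_U] × U(W_i)(𝔸): jointly measurable and bounded
  (hk : Measurable (Function.uncurry (thetaFn D GU φ))) {Ck : ℝ} (hCk : 0 ≤ Ck)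
  (hkC : ∀ q u, ‖thetaFn D GU φ q u‖ ≤ Ck)

include hW hh hjA hj h𝓕 hχΓ hχVΓ P hφ hloc hK hM X hTS hT'S hclS hsum ram_pos in
/-- **Lemma 4.2(b)'s conclusion `Θ(χ′) ≠ 0` for the GENUINE THETA LIFT** — with `[G_U]` of finite
invariant volume and the theta kernel `θ_φ(g,u) = Θ(ω(u,g)φ)` jointly measurable and bounded, the
vector `θ_φ(χ′) := ∫_𝓕 θ_φ(·,u) χ′(u) du ∈ L²([G_U])` (pv05 `PeterssonFubini.theta`, tex l. 594) is
NON-ZERO.  Composition of `theta_ne_zero_of_N31d` with pv05's Fubini identity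
`PeterssonFubini.inner_theta_theta_restrict` (the binder `hnorm`, tex ll. 594–596) for the kernel
`K := thetaKernel D GU φ`; `E`, `θ`, `Θ`, `hnorm` are no longer inputs. -/
theorem thetaLift_ne_zero_of_N31d :
    PeterssonFubini.theta GU.μ (((haarDatum B hBc hBo S₀).μ).restrict 𝓕) hk
      (measurable_coe_char B hBo χ hχT' hlocχ) hCk hkC (norm_coe_char_le χ) ≠ 0 :=
  theta_ne_zero_of_N31d B hBc hBo S₀ hW hh D GU jA hjA j hj h𝓕 χ hχΓ hχVΓ P φ hφ hloc hχT' hlocχ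
    hK hM X hTS hT'S hclS hsum
    (by rw [← Measure.restrict_apply_univ 𝓕]; exact measure_ne_top _ _) _ Set.univ (Set.mem_univ _)
    (PeterssonFubini.inner_theta_theta_restrict GU.μ hk (measurable_coe_char B hBo χ hχT' hlocχ)
      hCk hkC (norm_coe_char_le χ) (haarDatum B hBc hBo S₀).μ 𝓕)
    ram_pos

end thetaLift

end HodgeCM.PerL34.PureTensor

end
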